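import Literature.AnabelianGeometry.EtaleTheta.SettingModelTateKummerData
import Literature.AnabelianGeometry.EtaleTheta.KummerDataYCoordFiltration
import HarnessLib

/-!
# The Tate-sheared stage-2 model of [EtTh] §1 (R78 F6q): `log(U) ∉ F²`, `log(U) ∈ F¹` in `KummerData.modelχq`

Mochizuki, *The étale theta function …*, Publ. RIMS **45** (2009) [EtTh], §1, Prop. 1.5 (i), PRIMS PDF p. 23
[cite: MochizukiEtTh2009, Prop 1.5 p.23]: `F² = H¹(G_K, Δ_Θ) ⥲ (K^×)^∧` (Kummer classes of constants),
`F¹/F² = Ẑ · log(U)`, `F⁰/F¹ = Hom(Δ_Θ, Δ_Θ) = Ẑ · log(Θ)`.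

PROOF-ONLY sequel (abc-iut cell, R78 cluster stage 2; seat abc-iut-w5-d181, on the GO of the F6q author
abc-iut-w5-d171, STATUS 2026-08-26T10:51:11Z) of `SettingModelTateKummerData.lean` (`kummerDataχq`, built from
`kummerCoreχq` + the `y`-coordinate kit `yCoordKitχq`): the GENERIC results of `KummerDataYCoordFiltration.lean`
instantiated at the stage-2 model `ThetaSetting.modelχq p i j hj` with the geometric element `b = (b, 0) ⋊ 1 ∈ Π^tp_Y`
(Galois part trivial, centralises `Δ_Θ`, `ŷ(b) = ι 1 ≠ 1`):

* `kummerDataχq_kumY_ne_logU`, `kummerDataχq_logU_not_mem_range_kumY` — **`log(U) ∉ F² = Im(kumY)`**;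
* `kummerDataχq_kumY_ne_logU_zpow`, `kummerDataχq_zpowers_logU_inf_range_kumY` — `log(U)^ℤ ∩ F² = 1`;
* `kummerDataχq_res_deltaTheta_logU` — **`log(U) ∈ F¹`** (`ŷ` vanishes on `Δ_Θ = c^Ẑ`).

HONEST FRAMING: SEMI-SYNTHETIC model (stage 2: Tate shear on the longitude) — consistency/non-vacuity evidence for
the typed interface only; nothing of [EtTh] is asserted; no definition, no new Prop fact; no side taken on
[IUTchIII] Cor. 3.12.
-/

noncomputable section

open Topology

namespace Literature.AnabelianGeometry.EtaleTheta.SettingModel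

open Literature.AnabelianGeometry.SemiGraphs

variable (p : ℕ) [Fact p.Prime] (i j : ℤ) (hj : Even j)

/-! ### The geometric witness `b ∈ Δ^tp_Y` at the stage-2 model -/

/-- `(b^t, 0) ⋊ 1 ∈ Π^tp_Y = Ker(Π^tp_X ↠ ℤ)` at `modelχq`. [cite: MochizukiEtTh2009, §1 p.13] -/
theorem inl_bPowGfp_mem_gtpY_modelχq (t : ZH) :
    (SemidirectProduct.inl (bPowGfp t) : PiTpχq p i j) ∈ (ThetaSetting.modelχq p i j hj).GtpY := by
  show (tateTwistData₀ p i j).toZ _ = 1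
  rw [GfpTwistData₀.toZ_apply, SemidirectProduct.left_inl, gfpSnd_bPowGfp]

/-- `aug^Θ(toTheta (inl γ)) = 1`: geometric elements have trivial Galois part. [cite: MochizukiEtTh2009, §1 p.12] -/
theorem augTheta_kummerCoreχq_toTheta_inl (γ : Gfp) :
    (kummerCoreχq p i j hj).augTheta (CurveTheta.toTheta (curveχq p i j) (SemidirectProduct.inl γ)) = 1 := rfl

/-- The kit's `ŷ` is `yThetaχq` (definitionally). [cite: MochizukiEtTh2009, Prop 1.5 p.23] -/
theorem yCoordKitχq_y : (yCoordKitχq p i j hj).y = yThetaχq p i j := rfl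

/-- The kit's `ι` is `deltaThetaCoordχq` (definitionally). [cite: MochizukiEtTh2009, §1 p.12] -/
theorem yCoordKitχq_iota : (yCoordKitχq p i j hj).iota = deltaThetaCoordχq p i j := rfl

/-- The kit's `ι` is injective. [cite: MochizukiEtTh2009, §1 p.12] -/
theorem yCoordKitχq_iota_injective : Function.Injective (yCoordKitχq p i j hj).iota := by
  rw [yCoordKitχq_iota]
  exact (bijective_deltaThetaCoordχq p i j).1

/-- `ŷ(b^t) = t` on the theta quotient of the stage-2 model. [cite: MochizukiEtTh2009, Prop 1.5 p.23] -/
theorem yCoordKitχq_y_inl_bPowGfp (t : ZH) :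
    (yCoordKitχq p i j hj).y (CurveTheta.toTheta (curveχq p i j) (SemidirectProduct.inl (bPowGfp t))) = t := by
  rw [yCoordKitχq_y, yThetaχq_toTheta, yCoordχq_inl_bPowGfp]

/-- `ŷ(b) = ι 1 ≠ 1`. [cite: MochizukiEtTh2009, Prop 1.5 p.23] -/
theorem yCoordKitχq_y_inl_b_ne_one :
    (yCoordKitχq p i j hj).y (CurveTheta.toTheta (curveχq p i j)
      (SemidirectProduct.inl (bPowGfp (iotaZ (Multiplicative.ofAdd 1))))) ≠ 1 := by
  rw [yCoordKitχq_y_inl_bPowGfp]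
  exact iotaZ_ofAdd_ne_one one_ne_zero

/-- The F6q Kummer data ARE the Kummer data of the F6q core, and their `log(U)` IS the kit's class (definitionally).
[cite: MochizukiEtTh2009, Prop 1.5 p.23] -/
theorem kummerDataχq_logU_eq : (kummerDataχq p i j hj).logU = (yCoordKitχq p i j hj).logU := rfl

/-! ### `log(U) ∉ F²` at the stage-2 model -/

/-- **`kumY u ≠ log(U)`** for every constant `u ∈ K^×`, at `modelχq`. [cite: MochizukiEtTh2009, Prop 1.5 p.23] -/
theorem kummerDataχq_kumY_ne_logU (u : (kummerCoreχq p i j hj).invY) :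
    (kummerDataχq p i j hj).kumY u ≠ (kummerDataχq p i j hj).logU :=
  (yCoordKitχq p i j hj).kumY_ne_logU (kummerCoreχq p i j hj) (yCoordKitχq_iota_injective p i j hj)
    ⟨_, inl_bPowGfp_mem_gtpY_modelχq p i j hj _, rfl⟩ (augTheta_kummerCoreχq_toTheta_inl p i j hj _)
    (conjNormal_toThetaq_eq_self p i j hj (SemidirectProduct.right_inl _)) (yCoordKitχq_y_inl_b_ne_one p i j hj) u

/-- **`log(U) ∉ F² = Im(kumY)`** at `modelχq`. [cite: MochizukiEtTh2009, Prop 1.5 p.23] -/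
theorem kummerDataχq_logU_not_mem_range_kumY :
    (kummerDataχq p i j hj).logU ∉ Set.range (kummerDataχq p i j hj).kumY := by
  rintro ⟨u, hu⟩
  exact kummerDataχq_kumY_ne_logU p i j hj u hu

/-- **`kumY u ≠ log(U)^n` for `n ≠ 0`** at `modelχq`. [cite: MochizukiEtTh2009, Prop 1.5 p.23] -/
theorem kummerDataχq_kumY_ne_logU_zpow (u : (kummerCoreχq p i j hj).invY) {n : ℤ} (hn : n ≠ 0) :
    (kummerDataχq p i j hj).kumY u ≠ (kummerDataχq p i j hj).logU ^ n :=
  (yCoordKitχq p i j hj).kumY_ne_logU_zpow (kummerCoreχq p i j hj) (yCoordKitχq_iota_injective p i j hj)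
    ⟨_, inl_bPowGfp_mem_gtpY_modelχq p i j hj _, rfl⟩ (augTheta_kummerCoreχq_toTheta_inl p i j hj _)
    (conjNormal_toThetaq_eq_self p i j hj (SemidirectProduct.right_inl _)) (yCoordKitχq_y_inl_b_ne_one p i j hj)
    hn u

/-- **`log(U)^ℤ ∩ F² = 1`** at `modelχq`. [cite: MochizukiEtTh2009, Prop 1.5 p.23] -/
theorem kummerDataχq_zpowers_logU_inf_range_kumY :
    Subgroup.zpowers (kummerDataχq p i j hj).logU ⊓ (kummerDataχq p i j hj).kumY.range = ⊥ :=
  (yCoordKitχq p i j hj).zpowers_logU_inf_range_kumY (kummerCoreχq p i j hj)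
    (yCoordKitχq_iota_injective p i j hj) ⟨_, inl_bPowGfp_mem_gtpY_modelχq p i j hj _, rfl⟩
    (augTheta_kummerCoreχq_toTheta_inl p i j hj _)
    (conjNormal_toThetaq_eq_self p i j hj (SemidirectProduct.right_inl _)) (yCoordKitχq_y_inl_b_ne_one p i j hj)

/-! ### `log(U) ∈ F¹` at the stage-2 model -/

/-- `Δ_Θ ≤ (Π^tp_Y)^Θ` at `modelχq` (`c^t = inl(c^t, 0)` has degree `0`). [cite: MochizukiEtTh2009, §1 p.13] -/
theorem deltaTheta_le_gtpY_map_modelχq :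
    (ThetaSetting.modelχq p i j hj).DeltaTheta ≤
      (ThetaSetting.modelχq p i j hj).GtpY.map (ThetaSetting.modelχq p i j hj).toTheta := by
  intro d hd
  obtain ⟨t, rfl⟩ := exists_cThetaχq_eq_of_mem_ker p i j hd
  refine ⟨SemidirectProduct.inl (cGfpχ t), ?_, (cThetaχq_apply p i j t).symm⟩
  show (tateTwistData₀ p i j).toZ _ = 1
  rw [GfpTwistData₀.toZ_apply, SemidirectProduct.left_inl]
  rfl

/-- `ŷ` vanishes on `Δ_Θ = c^Ẑ` at `modelχq`. [cite: MochizukiEtTh2009, Prop 1.5 p.23] -/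
theorem yCoordKitχq_y_eq_one_of_mem_deltaTheta (d : (ThetaSetting.modelχq p i j hj).GtpTheta)
    (hd : d ∈ (ThetaSetting.modelχq p i j hj).DeltaTheta) : (yCoordKitχq p i j hj).y d = 1 := by
  obtain ⟨t, rfl⟩ := exists_cThetaχq_eq_of_mem_ker p i j hd
  rw [yCoordKitχq_y, cThetaχq_apply, yThetaχq_toTheta, yCoordχq_apply, SemidirectProduct.left_inl, gfpFst_cGfpχ]
  exact eHatB_powHat_commutator t

/-- **`log(U)|_{Δ_Θ} = 1`** at `modelχq`: `log(U) ∈ F¹`. [cite: MochizukiEtTh2009, Prop 1.5 p.23] -/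
theorem kummerDataχq_res_deltaTheta_logU :
    ContH1.res (MonoidHom.id (ThetaSetting.modelχq p i j hj).GtpTheta) (ThetaSetting.modelχq p i j hj).DeltaTheta
      (deltaTheta_le_gtpY_map_modelχq p i j hj) (kummerDataχq p i j hj).logU = 1 :=
  (yCoordKitχq p i j hj).res_deltaTheta_logU (deltaTheta_le_gtpY_map_modelχq p i j hj)
    (yCoordKitχq_y_eq_one_of_mem_deltaTheta p i j hj)

end Literature.AnabelianGeometry.EtaleTheta.SettingModel

end

-- tree-health (abc-iut-w6-d081 g4, 2026-08-26T12:54Z): comment-only re-land of a STRANDED ACCEPT (module accepted, not importable on the farm for > 90 min);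
-- declarations byte-identical to the accepted version; purpose = trigger the rebuild (w4-d014 10:34:09Z remedy class). No content change.
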